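/-
Origin: expansion seat `planner-pub-hodgecm-pv02-g5-0`, handover #3 2026-08-18T08:44:45Z (`HOME/pub-hodgecm-pv02-g5/lean/Pv02g5/ArchAWeilSchrodinger.lean`, md5 c2efa886, 165 lines);
landed by the gen-7 packager in gate run 27 as `HodgeCM/PerL34/ArchAWeilSchrodinger.lean` (import ^import Pv14g4\.→import HodgeCM.Automorphic. ×1; import ^import Pv[0-9]+g[0-9]+\.→import HodgeCM.PerL34. ×1).
-/
/-
Copyright (c) 2026. All rights reserved.
Released under Apache 2.0 license as described in the file LICENSE.
PerL v5 cell `pub-hodgecm` — DAG node N27 (L4.1(a)) OVER A CONSTRUCTED MODEL: the archimedean Schrödinger–lattice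
`WeilThetaModel` of pv14-g4.  Unit pub-hodgecm-pv02-g5 (DAG-node prover #02, gen 5), file #3.

KIND: KERNEL (Mathlib + tree only; NO hypotheses of kind PRINT / DEF / dictionary record).
-/
import Summits.HodgeConjecture.HodgeCM.PerL34.ArchAWeil_2
import Summits.HodgeConjecture.HodgeCM.Automorphic.WeilThetaModelSchrodinger
import Mathlib.Algebra.Module.ZLattice.Basic
import Mathlib.MeasureTheory.Constructions.BorelSpace.Basic

/-!
# N27 (`ArchA.LineArchData.N27_statement`) holds UNCONDITIONALLY over the Schrödinger–lattice Weil theta model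

pv14-g4's `HodgeCM.SchwartzWeil.schrodingerModel E L m Γ hΓ : WeilThetaModel (Multiplicative E) (latticeSubgroup E L)
Circle Γ` (run 27) is an INHABITANT of prl1-g4's kernel-model record in which every field is a theorem: `E` a
finite-dimensional real normed space, `L ⊆ E` a discrete `ℤ`-lattice, `U(W) ↦ U(1) = Circle` acting on `𝓢(E, ℂ)` by the
weight-`m` character, `Θ_Φ(S) = Σ_{v ∈ L} (SΦ)(v)` [We64 n° 41].  This file feeds it to the N27 line datum of file #1
(`ArchAWeil.lineData`, with `ι_b := id : U(1) →* U(1)` at every real place `b`) and proves N27 with NO hypothesis left: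

* `compactSpace_quotient_lattice` — `[G_U] = E ⧸ L` is compact when `L` is a full lattice (`IsZLattice ℝ L`; Mathlib
  `IsZLattice.isCompact_range_of_periodic`);
* `θ_omg_schrodinger : θ_{ω(u)Φ} = u ^ m • θ_Φ` — in this model EVERY theta kernel is a `U(1)`-eigenvector of weight `m`,
  so the PRINT input of file #1 ([BW] VIII 2.7(1), `KernelWeightDecomposition`) is a one-line THEOREM
  (`kernelWeightDecomposition_schrodinger`, one summand);
* **`N27_schrodinger : (lineData (schrodingerModel E L m Γ hΓ) ι₁ (fun _ => MonoidHom.id Circle) kJ).N27_statement`**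
  — PerL v5 L4.1(a) for a model built from Mathlib alone: `thetaKernel`, `weightAction` (file #1, unconditional) and
  `WeightDecomposition` (here) are all theorems, and `ArchA.LineArchData.N27_of` concludes.

HONEST SCOPE.  This is the rank-one archimedean SHADOW of the adelic machine (pv14-g4's dictionary: `X_k ↦ L`,
`S(X_A) ↦ 𝓢(E,ℂ)`, `Mp ↦ Multiplicative E × Circle`), not PerL's adelic `U(2,1)`-situation; its point is that the N27
pipeline `WeilThetaModel → LineArchData → N27_statement` (files #1/#2) is NON-VACUOUS and closes in the kernel on a
genuinely constructed model — the archimedean junction of GAPS carverg2-X1 (the un-built adelic theta MODEL).  In this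
model only the weight `k = m` occurs, so N27 says: a lift `Θ_{χ'}(θ_φ)` can be non-zero only if `χ'_b = u ↦ u^{k_J(b)}`
on the image of `U(1)`, and (by `weightAction`) only weight-`k_J(b)` vectors contribute — exactly tex ll. 473–477.

Borel structure on `U(1) ⧸ Γ`: the Borel σ-algebra (`borelCircleQuot`, priority high; Mathlib's
`Quotient.instMeasurableSpace` is disabled in this file, as in file #1).
-/

noncomputable section

open HodgeCM.PerL34 HodgeCM.PerL34.ArchA Module MeasureTheory

attribute [-instance] Quotient.instMeasurableSpace

namespace HodgeCM
namespace PerL34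
namespace ArchAWeil

/-! ## 1. Instances: compactness of `E ⧸ L`, Borel structure on `U(1) ⧸ Γ` -/

section Lattice

variable (E : Type) [NormedAddCommGroup E] [NormedSpace ℝ E] [FiniteDimensional ℝ E]
  (L : Submodule ℤ E) [DiscreteTopology L]

/-- `[G_U] = E ⧸ L` is compact for a full `ℤ`-lattice `L` (the continuous `L`-periodic map `E → E ⧸ L` has compact
range, Mathlib `IsZLattice.isCompact_range_of_periodic`, and is onto). -/
instance compactSpace_quotient_lattice [IsZLattice ℝ L] :
    CompactSpace (Multiplicative E ⧸ SchwartzWeil.latticeSubgroup E L) := by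
  refine ⟨?_⟩
  have hper : ∀ z w : E, w ∈ L →
      (QuotientGroup.mk (Multiplicative.ofAdd (z + w)) : Multiplicative E ⧸ SchwartzWeil.latticeSubgroup E L) =
        QuotientGroup.mk (Multiplicative.ofAdd z) := by
    intro z w hw
    rw [QuotientGroup.eq, SchwartzWeil.mem_latticeSubgroup, toAdd_mul, toAdd_inv, toAdd_ofAdd, toAdd_ofAdd,
      neg_add_rev, add_assoc, neg_add_cancel, add_zero]
    exact L.neg_mem hw
  have h := IsZLattice.isCompact_range_of_periodic L
    (fun z : E => (QuotientGroup.mk (Multiplicative.ofAdd z) : Multiplicative E ⧸ SchwartzWeil.latticeSubgroup E L))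
    ((QuotientGroup.continuous_mk).comp continuous_ofAdd) hper
  have hr : Set.range (fun z : E =>
      (QuotientGroup.mk (Multiplicative.ofAdd z) : Multiplicative E ⧸ SchwartzWeil.latticeSubgroup E L)) =
      Set.univ := by
    refine Set.eq_univ_of_forall fun x => ?_
    obtain ⟨a, rfl⟩ := QuotientGroup.mk_surjective x
    exact ⟨Multiplicative.toAdd a, rfl⟩
  rwa [hr] at h

end Lattice

/-- The Borel σ-algebra on `[U(W)] = U(1) ⧸ Γ`. -/
instance (priority := high) borelCircleQuot (Γ : Subgroup Circle) : MeasurableSpace (Circle ⧸ Γ) := borel _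

/-- (Ported verbatim from the HodgeCMPerL package; no docstring in the source.) -/
instance borelSpace_circleQuot (Γ : Subgroup Circle) : BorelSpace (Circle ⧸ Γ) := ⟨rfl⟩

/-! ## 2. Every theta kernel of the Schrödinger–lattice model has weight `m` -/

section Model

variable (E : Type) [NormedAddCommGroup E] [NormedSpace ℝ E] [FiniteDimensional ℝ E]
  (L : Submodule ℤ E) [DiscreteTopology L] (m : ℤ) (Γ : Subgroup Circle) (hΓ : ∀ u ∈ Γ, u ^ m = 1)

/-- **`θ_{ω(u)Φ} = u^m • θ_Φ`**: `U(W) = U(1)` acts on every theta kernel of the model by the weight-`m` character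
(`θ_omg` of prl1-g4 + pv14-g4's closed form `θ_Φ(aL, uΓ) = u^{-m} Σ_{v∈L} Φ(a+v)`). -/
theorem θ_omg_schrodinger (u : Circle) (Φ : (SchwartzWeil.schrodingerModel E L m Γ hΓ).SK) :
    (SchwartzWeil.schrodingerModel E L m Γ hΓ).θ ((SchwartzWeil.schrodingerModel E L m Γ hΓ).omg u Φ) =
      ((u : ℂ) ^ m) • (SchwartzWeil.schrodingerModel E L m Γ hΓ).θ Φ := by
  obtain ⟨Φ, hΦ⟩ := Φ
  ext p
  obtain ⟨ξ, q⟩ := p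
  rw [ContinuousMap.smul_apply, WeilThetaModel.θ_omg]
  induction ξ using QuotientGroup.induction_on with
  | H a =>
    induction q using QuotientGroup.induction_on with
    | H w =>
      rw [MulAction.Quotient.smul_mk, smul_eq_mul]
      have h1 := SchwartzWeil.schrodingerModel_θ_mk E L m Γ hΓ Φ a (u⁻¹ * w)
      have h2 := SchwartzWeil.schrodingerModel_θ_mk E L m Γ hΓ Φ a w
      rw [h1, h2, smul_eq_mul, Circle.coe_mul, Circle.coe_inv, mul_zpow, mul_inv, inv_zpow, inv_inv, mul_assoc]

/-- **[BW] VIII 2.7(1) is a THEOREM in the model**: every kernel is its own one-term weight decomposition (weight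
`m`), at every real place `b` (all mapped by `id : U(1) →* U(1)`). -/
theorem kernelWeightDecomposition_schrodinger {RealPl : Type} :
    KernelWeightDecomposition (SchwartzWeil.schrodingerModel E L m Γ hΓ)
      (fun _ : RealPl => MonoidHom.id Circle) := by
  intro b Φ
  refine ⟨1, fun _ => Φ, fun _ => m, ?_, fun _ u => ?_⟩
  · rw [Fin.sum_univ_one]
  · rw [MonoidHom.id_apply]
    exact θ_omg_schrodinger E L m Γ hΓ u Φ

/-! ## 3. N27 over the model, unconditionally -/

variable [IsZLattice ℝ L] {RealPl : Type} (ι₁ : RealPl) (kJ : RealPl → ℤ)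

/-- The N27 line datum of the Schrödinger–lattice model (file #1's `lineData`; all instance hypotheses discharged). -/
abbrev schrodingerLineData : LineArchData :=
  lineData (SchwartzWeil.schrodingerModel E L m Γ hΓ) ι₁ (fun _ : RealPl => MonoidHom.id Circle) kJ

/-- `WeightDecomposition` for the model's line datum — a THEOREM. -/
theorem weightDecomposition_schrodinger : (schrodingerLineData E L m Γ hΓ ι₁ kJ).WeightDecomposition :=
  weightDecomposition_of_kernel _ ι₁ _ kJ (kernelWeightDecomposition_schrodinger E L m Γ hΓ)

/-- `ThetaKernel` for the model's line datum (file #1, unconditional; restated by name). -/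
theorem thetaKernel_schrodinger : (schrodingerLineData E L m Γ hΓ ι₁ kJ).ThetaKernel :=
  thetaKernel _ ι₁ _ kJ

/-- `WeightAction` for the model's line datum (file #1, unconditional; restated by name). -/
theorem weightAction_schrodinger : (schrodingerLineData E L m Γ hΓ ι₁ kJ).WeightAction :=
  weightAction _ ι₁ _ kJ

/-- **N27 = PerL v5 L4.1(a) (tex ll. 473–477) over the Schrödinger–lattice Weil theta model — NO hypothesis**:
for every automorphic character `χ'` of `[U(W)] = U(1) ⧸ Γ` and every `φ` in the kernel span, a non-zero lift
`Θ_{χ'}(θ_φ)` forces `χ' ∘ ι_b = (u ↦ u^{k_J(b)})` at every real place and only the weight-`k_J(b)` component of `φ`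
contributes. -/
theorem N27_schrodinger : (schrodingerLineData E L m Γ hΓ ι₁ kJ).N27_statement :=
  N27_ofWeilModel _ ι₁ _ kJ (kernelWeightDecomposition_schrodinger E L m Γ hΓ)

/-- The same for pv14-g4's simplest model `Γ = ⊥`, with the lattice `L`, the weight `m` and the book-keeping data
`ι₁, k_J` as the only parameters. -/
theorem N27_schrodingerBot :
    (lineData (SchwartzWeil.schrodingerModelBot E L m) ι₁ (fun _ : RealPl => MonoidHom.id Circle) kJ).N27_statement :=
  N27_schrodinger E L m ⊥ _ ι₁ kJ

end Model

end ArchAWeil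
end PerL34
end HodgeCM

end
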